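import Summits.QuantumFields.YangMills.Theses.BalabanUVNodes
import Summits.QuantumFields.YangMills.Theorems.BalabanUVNodesN27AtRecord13
import Summits.QuantumFields.YangMills.Theorems.BalabanUVNodesN27AtRecord13HomeOn
import Summits.QuantumFields.YangMills.Theorems.BalabanUVNodesN27AtReadingOfRecord13

/-!
# BalabanUVNodes ∕ N27 = binder B5 AT THE RECORD, XXXVII — THE ROUTE-FACING FACES OF THE RE-KEYED ITEM K3‴ `Theses.BalabanUVNodes.SpineGivenEndpointR13`
# (route `route-QuantumFields-BalabanUVNodes` rev 16∕17, stmt-QuantumFields-19912: K3′'s text MECHANICALLY re-keyed to NODE 00's Stage-13 record — director-ym ★★ №125 (3):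
# «∀ F θ h, (θ.ZtUnity F 2 ∧ θ.SlotsNondegenerate₁₃ F 2) → θ.Admissible F 2 → (B) → END → HybridNE7Under (datumOfRecord₁₃ F 2 θ h) END»; K3′ `SpineGivenEndpointR12`
# (stmt-QuantumFields-19908) went ASIDE with its history — modules XXVI ∕ XXIX–XXXV): the item ⟺ its guarded θ-keyed B5 sentence ⟺ B5 `Spine` at RR-2's CN record class
# `Node00.IsRecordOfRecord₁₃CN F 2`; the item from `Spine ₁₃C` (XXXVI §4), hence from `Spine ₅C` ∕ any record predicate coarser than ₅C ∕ the two cluster statements at ₁₃C ∕ the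
# rev-1 stub shape at parametric carrier records (XIV); from the children's estimates KEYED at the Stage-13 tuples and asked ONLY on the guarded class (the BC3 composer, XXXVI §5 —
# the unbundled, guard-restricted form of plan g66's registered composition `K3Skeleton13.SpineGivenEndpointR13_of`); from K5 «SpineDatum» (and K4's hook) keyed at the guarded
# tuples; from the stub instances at the ₁₃ CARRIER HOMES of record — canonical (dag-n20-d `SRec₁₃ cr`, dag-n22-e `RRec₁₃ 𝔯`; module XXXVIII) and regime-restricted AT THE ITEM's
# OWN GUARD (`SRec₁₃On` ∕ `RRec₁₃On`; module XXXIX, the guard reaching every hypothesis); every theorem ONE application BY NAME with the item's name in the conclusion — the ₁₃ twin of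
# module XXVI §§1–6 (its §7, the knit at the rate READING of record, follows append-only when dag-n22-e's 6″ `readingOfRecord₁₃` module lands)
# (cell `pub-ymgap`, HUMAN RULING D-0062 Track A, R134 seat `pub-ymgap-dag-n27-c` (s2) gen 6; `--supports stmt-QuantumFields-19912 --as helper`; COUNT-NEUTRAL; route-facing
# LEAF: imports the route file — nothing may import this module, lint.theses-cone)

HONEST FRAMING.  COMPOSITE-node bookkeeping: every K4–K5 stub ∕ reading ∕ edge ∕ `Spine ₅C` premise is a HYPOTHESIS with NO producer at the Stage-13 record today (0∕1; the
children's ₁₃ re-keying is in progress); `cr`, `rr`, `SRec`, `RRec`, `Inputs` PARAMETERS; the item K3‴ is NOT proved here and NOT claimed; inhabitation of the guarded class at `N = 2`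
is K0‴ `Record13Inhabited` (stmt-QuantumFields-19909, open) and is neither used nor claimed; (B) and END are the item's antecedents, used by modus ponens inside B5 only; at Stage 13
the Stage-11 vacuity mechanism is ABSENT (XXXVI `not_levelZeroNegative_datumOfRecord₁₃`); nothing of Bałaban's is instantiated or asserted; NE7 ∕ NE7b ∕ NE7c NOT PRINTED for d = 4
and NOT PROVED; NO node discharged; counts UNMOVED (typed 28∕28 · discharged 5∕27, A 5∕28); one finite four-torus programme at fixed `ε` — NOT ℝ⁴, NOT infinite volume, NOT OS,
NOT a mass gap, NOT Clay.  0 `def`, 0 `sorry`.  No decl below carries a cite tag.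
-/

namespace Summit.QuantumFields.YangMills.Theorems.BalabanUVNodesN27SpineRecord

open Literature.MathematicalPhysics.QuantumFieldTheory.Balaban1983to89
open Literature.MathematicalPhysics.QuantumFieldTheory.Balaban1983to89.T4Continuum
open T4WeightBudget (RelWeightBound)
open T4IndicatorShell (ShellWeightBound)
open T4ContinuumYM4Torus (ForSmallCouplings)
open Summit.QuantumFields.BalabanUV.T4Continuum.Spine
open Summit.QuantumFields.YangMills.Theses.BalabanUVNodes (SpineGivenEndpointR13)
open YMDAG.UVSplit
open Node00 (Stage13Params datumOfRecord₁₃ IsRecordOfRecord₁₃C)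

/-! ## §1 The item ⟺ its unity-keyed B5 sentence; the item from `Spine ₁₃C`, from `Spine ₅C`, from any coarser record predicate -/

section ItemFaces

/-- **THE ITEM IS «B5 AT EVERY UNITY-, SLOT-NONDEGENERATE-, ADMISSIBLE STAGE-13 DATUM OF RECORD OF `SU(2)` DATA»**: its two displayed antecedents (B), END are
B5-under-END's own
(`FiniteEpsData.UnderHypotheses`, definitional) — →: apply at them twice; ←: weaken. [bookkeeping] -/
theorem spineGivenEndpointR13_iff_keyedGuarded :
    SpineGivenEndpointR13 ↔ ∀ (F : T4Family) (θ : Stage13Params F 2) (hP : θ.Provisos₁₃ F 2), (θ.ZtUnity F 2 ∧ θ.SlotsNondegenerate₁₃ F 2) → θ.Admissible F 2 →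
      T4ApexHybrid.HybridNE7Under (datumOfRecord₁₃ F 2 θ hP) (DagBinding.EndpointExistence (datumOfRecord₁₃ F 2 θ hP).C.toB12) := by
  refine ⟨fun h F θ hP hG hθ => ?_, fun h F θ hP hG hθ _ _ => h F θ hP hG hθ⟩
  show (datumOfRecord₁₃ F 2 θ hP).UnderHypotheses _ fun g₀ => T4ApexHybrid.StringwiseHybridNE7 ((datumOfRecord₁₃ F 2 θ hP).scheme g₀)
  intro hB hEnd
  exact h F θ hP hG hθ hB hEnd hB hEnd

/-- **`Spine ₁₃C` AT `N = 2` GIVES THE ITEM** (XXXVI `keyedGuarded₁₃_of_spine_rec13C` at the item's guard: guard, (B), END unused — B5 at EVERY ₁₃C record is stronger). [bookkeeping] -/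
theorem spineGivenEndpointR13_of_spine_rec13C (h : Spine (N := 2) fun F D w => IsRecordOfRecord₁₃C F 2 D w) : SpineGivenEndpointR13 :=
  fun F θ hP hG hθ hB hE => keyedGuarded₁₃_of_spine_rec13C (fun θ => θ.ZtUnity _ 2 ∧ θ.SlotsNondegenerate₁₃ _ 2) h F θ hP hG hθ hB hE

/-- **THE ITEM FROM `Spine` AT THE STAGE-5 RECORD PREDICATE** (`N = 2`; XXXVI `spine_rec13C_of_spine_rec5C`, shadow road).  The premise has NO producer today. [bookkeeping] -/
theorem spineGivenEndpointR13_of_spine_rec5C (h₅ : Spine (N := 2) fun F D w => Node00.IsRecordOfRecord₅C F 2 D w) : SpineGivenEndpointR13 :=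
  spineGivenEndpointR13_of_spine_rec13C (spine_rec13C_of_spine_rec5C h₅)

/-- The item from B5 at ANY record predicate coarser than ₅C (`N = 2`; XXXVI `spine_rec13C_of_coarser`, tower road). [bookkeeping] -/
theorem spineGivenEndpointR13_of_coarser {Rec : RecordPred 2}
    (hle : ∀ (F : T4Family) (D : Datum F 2) (w : DagBinding.WorldP), Node00.IsRecordOfRecord₅C F 2 D w → Rec F D w) (h : Spine Rec) :
    SpineGivenEndpointR13 :=
  spineGivenEndpointR13_of_spine_rec13C (spine_rec13C_of_coarser hle h)

end ItemFaces

/-! ## §2 The knits: from the cluster statements, from the rev-1 stub shape at parametric carrier records, from the unity-guarded keyed faces (the BC3 composer) -/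

section Knits

variable (Inputs : InputsPred 2) (SRec : SpineRecordPred 2) (RRec : RateRecordPred 2)

/-- **THE ITEM FROM THE TWO CLUSTER STATEMENTS AT THE STAGE-13 RECORD** (`N = 2`): K4's hook `SpineRates ₁₃C Inputs` and K5 `SpineMatching ₁₃C Inputs` (the route module's glue
`YMDAG.UVSplit.B5_at_record` BY NAME). [bookkeeping] -/
theorem spineGivenEndpointR13_of_spineRates_spineMatching (h4 : SpineRates (fun F D w => IsRecordOfRecord₁₃C F 2 D w) Inputs)
    (h5 : SpineMatching (fun F D w => IsRecordOfRecord₁₃C F 2 D w) Inputs) : SpineGivenEndpointR13 :=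
  spineGivenEndpointR13_of_spine_rec13C (B5_at_record _ Inputs h4 h5)

/-- **THE ITEM FROM THE SEVEN K4 STUBS AND THE REV-1 K5 AT PARAMETRIC CARRIER RECORDS** (`N = 2`; XIV `spine_of_rateStubs_coreEdge` at ₁₃C): R00x · N14–N18 · N22 at `RRec` · N27x · N20 ·
N21 at `SRec` · the N19′ ∃δ-edge. [bookkeeping] -/
theorem spineGivenEndpointR13_of_rateStubs_coreEdge
    (hx : S_R00x (fun F D w => IsRecordOfRecord₁₃C F 2 D w) RRec) (h14 : S_N14 RRec) (h15 : S_N15 RRec) (h16 : S_N16 RRec)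
    (h17 : S_N17 RRec) (h18 : S_N18 RRec) (h22 : S_N22 RRec) (hx' : S_N27x (fun F D w => IsRecordOfRecord₁₃C F 2 D w) SRec)
    (h20 : S_N20 SRec) (h21 : S_N21 SRec)
    (h19 : ∀ (F : T4Family) (D : Datum F 2) (g₀ : ℕ → ℝ) (os : List (ULoop F)) (S : SpineCarriers) (R : RateCarriers 2),
      SRec F D g₀ os S → RRec F D g₀ os R → RatesAt D R → letI := S.dec
        ∃ δ : ℕ → ℝ, NE7.Core S.l₀ S.vol S.T S.Bad (fun K t τ => S.A K t τ - S.shA K t τ) (fun K t τ => S.B K t τ - S.shB K t τ) δ ∧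
          Summable δ) :
    SpineGivenEndpointR13 :=
  spineGivenEndpointR13_of_spine_rec13C (spine_of_rateStubs_coreEdge _ SRec RRec hx h14 h15 h16 h17 h18 h22 hx' h20 h21 h19)

variable (cr : (F : T4Family) → (θ : Stage13Params F 2) → θ.Provisos₁₃ F 2 → (ℕ → ℝ) → List (ULoop F) → SpineCarriers)
  (rr : (F : T4Family) → (θ : Stage13Params F 2) → θ.Provisos₁₃ F 2 → (ℕ → ℝ) → List (ULoop F) → RateCarriers 2)

/-- **THE BC3 COMPOSER: THE ITEM FROM THE CHILDREN'S ESTIMATES KEYED AT THE STAGE-13 TUPLES, ASKED ONLY ON THE GUARDED CLASS** (`N = 2`; XXXVI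
`keyedGuarded₁₃_of_keyedFaces` = XXIVb `forall_guarded_of_keyedFaces` at the Stage-13 key with guard `G θ := θ.ZtUnity F 2 ∧ θ.SlotsNondegenerate₁₃ F 2` — print's partition of unity and
non-degenerate present slots, director LINES №99 (2) ∕ №108 ∕ №118; the unbundled form of plan g66's registered composition `K3Skeleton13.SpineGivenEndpointR13_of`, guard-restricted): for readings `cr` ∕ `rr` off `(θ, h)` — at every Stage-13 θ with provisos satisfying the guard `θ.ZtUnity F 2 ∧ θ.SlotsNondegenerate₁₃ F 2` and `θ.Admissible F 2`, every `g₀`, `os`: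
N20 `RelWeightBound` and N21 `ShellWeightBound` at `cr F θ h g₀ os` · K4's six rates `RatesAt (datumOfRecord₁₃ F 2 θ h) (rr F θ h g₀ os)` · the same-tuple N19′ ∃δ-edge · the keyed
extraction clause (positivity + E1∕E2 under (B), END, small tuned couplings) ⇒ `SpineGivenEndpointR13`.  Every hypothesis 0∕1 today; `cr`, `rr` PARAMETERS. [bookkeeping] -/
theorem spineGivenEndpointR13_of_keyedFaces
    (h20 : ∀ (F : T4Family) (θ : Stage13Params F 2) (hP : θ.Provisos₁₃ F 2), (θ.ZtUnity F 2 ∧ θ.SlotsNondegenerate₁₃ F 2) → θ.Admissible F 2 →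
      ∀ (g₀ : ℕ → ℝ) (os : List (ULoop F)),
      RelWeightBound (cr F θ hP g₀ os).l₀ (cr F θ hP g₀ os).T (cr F θ hP g₀ os).A (cr F θ hP g₀ os).B (cr F θ hP g₀ os).Bad (cr F θ hP g₀ os).W)
    (h21 : ∀ (F : T4Family) (θ : Stage13Params F 2) (hP : θ.Provisos₁₃ F 2), (θ.ZtUnity F 2 ∧ θ.SlotsNondegenerate₁₃ F 2) → θ.Admissible F 2 →
      ∀ (g₀ : ℕ → ℝ) (os : List (ULoop F)),
      ShellWeightBound (cr F θ hP g₀ os).l₀ (cr F θ hP g₀ os).T (cr F θ hP g₀ os).A (cr F θ hP g₀ os).B (cr F θ hP g₀ os).shA (cr F θ hP g₀ os).shB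
        (cr F θ hP g₀ os).Wsh)
    (hrates : ∀ (F : T4Family) (θ : Stage13Params F 2) (hP : θ.Provisos₁₃ F 2), (θ.ZtUnity F 2 ∧ θ.SlotsNondegenerate₁₃ F 2) → θ.Admissible F 2 →
      ∀ (g₀ : ℕ → ℝ) (os : List (ULoop F)), RatesAt (datumOfRecord₁₃ F 2 θ hP) (rr F θ hP g₀ os))
    (h19 : ∀ (F : T4Family) (θ : Stage13Params F 2) (hP : θ.Provisos₁₃ F 2), (θ.ZtUnity F 2 ∧ θ.SlotsNondegenerate₁₃ F 2) → θ.Admissible F 2 →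
      ∀ (g₀ : ℕ → ℝ) (os : List (ULoop F)),
      RatesAt (datumOfRecord₁₃ F 2 θ hP) (rr F θ hP g₀ os) → letI := (cr F θ hP g₀ os).dec
        ∃ δ : ℕ → ℝ, NE7.Core (cr F θ hP g₀ os).l₀ (cr F θ hP g₀ os).vol (cr F θ hP g₀ os).T (cr F θ hP g₀ os).Bad
          (fun K t τ => (cr F θ hP g₀ os).A K t τ - (cr F θ hP g₀ os).shA K t τ) (fun K t τ => (cr F θ hP g₀ os).B K t τ - (cr F θ hP g₀ os).shB K t τ) δ ∧
          Summable δ)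
    (hx : ∀ (F : T4Family) (θ : Stage13Params F 2) (hP : θ.Provisos₁₃ F 2), (θ.ZtUnity F 2 ∧ θ.SlotsNondegenerate₁₃ F 2) → θ.Admissible F 2 →
      B16.EndStatementBPrinted (datumOfRecord₁₃ F 2 θ hP).C → DagBinding.EndpointExistence (datumOfRecord₁₃ F 2 θ hP).C.toB12 →
        ForSmallCouplings (datumOfRecord₁₃ F 2 θ hP) fun g₀ => ∀ os : List (ULoop F),
          0 < (cr F θ hP g₀ os).l₀ ∧ 0 < (cr F θ hP g₀ os).vol ∧
          (∀ (K : ℕ) (t : ℝ), |t| ≤ (cr F θ hP g₀ os).l₀ →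
            T4GenFunBounds.schemeZ ((datumOfRecord₁₃ F 2 θ hP).scheme g₀) os ((cr F θ hP g₀ os).K₀ + K) t =
              ∑ τ ∈ (cr F θ hP g₀ os).T K, (cr F θ hP g₀ os).A K t τ) ∧
          (∀ (K : ℕ) (t : ℝ), |t| ≤ (cr F θ hP g₀ os).l₀ →
            T4GenFunBounds.schemeZ ((datumOfRecord₁₃ F 2 θ hP).scheme g₀) os ((cr F θ hP g₀ os).K₀ + K + 1) t =
              ∑ τ ∈ (cr F θ hP g₀ os).T K, (cr F θ hP g₀ os).B K t τ)) :
    SpineGivenEndpointR13 :=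
  fun F θ hP hG hθ _ _ =>
    keyedGuarded₁₃_of_keyedFaces cr rr (fun θ => θ.ZtUnity _ 2 ∧ θ.SlotsNondegenerate₁₃ _ 2) h20 h21 hrates h19 hx F θ hP hG hθ

/-- **THE ITEM FROM THE STUB INSTANCES OF A DIVIDED STAGE-13 CARRIER HOME AND THE PAIR-FORM N19′ EDGE** (`N = 2`; XXXVI `spine_rec13C_of_rateStubs_twoKeys₁₃`; the stubs are asked at EVERY
admissible θ — stronger than the guarded class needs). [bookkeeping] -/
theorem spineGivenEndpointR13_of_rateStubs_twoKeys₁₃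
    (hkeyS : ∀ (F : T4Family) (D : Datum F 2) (g₀ : ℕ → ℝ) (os : List (ULoop F)) (S : SpineCarriers), SRec F D g₀ os S ↔
      ∃ (θ : Stage13Params F 2) (hP : θ.Provisos₁₃ F 2), θ.Admissible F 2 ∧ D = datumOfRecord₁₃ F 2 θ hP ∧ S = cr F θ hP g₀ os)
    (hkeyR : ∀ (F : T4Family) (D : Datum F 2) (g₀ : ℕ → ℝ) (os : List (ULoop F)) (R : RateCarriers 2), RRec F D g₀ os R ↔
      ∃ (θ : Stage13Params F 2) (hP : θ.Provisos₁₃ F 2), θ.Admissible F 2 ∧ D = datumOfRecord₁₃ F 2 θ hP ∧ R = rr F θ hP g₀ os)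
    (hx : S_R00x (fun F D w => IsRecordOfRecord₁₃C F 2 D w) RRec) (h14 : S_N14 RRec) (h15 : S_N15 RRec) (h16 : S_N16 RRec) (h17 : S_N17 RRec)
    (h18 : S_N18 RRec) (h22 : S_N22 RRec) (hx' : S_N27x (fun F D w => IsRecordOfRecord₁₃C F 2 D w) SRec) (h20 : S_N20 SRec) (h21 : S_N21 SRec)
    (h19₂ : ∀ (F : T4Family) (θ : Stage13Params F 2) (hP : θ.Provisos₁₃ F 2) (θ' : Stage13Params F 2) (hP' : θ'.Provisos₁₃ F 2),
      θ.Admissible F 2 → θ'.Admissible F 2 → datumOfRecord₁₃ F 2 θ' hP' = datumOfRecord₁₃ F 2 θ hP → ∀ (g₀ : ℕ → ℝ) (os : List (ULoop F)),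
        RatesAt (datumOfRecord₁₃ F 2 θ hP) (rr F θ' hP' g₀ os) → letI := (cr F θ hP g₀ os).dec
          ∃ δ : ℕ → ℝ, NE7.Core (cr F θ hP g₀ os).l₀ (cr F θ hP g₀ os).vol (cr F θ hP g₀ os).T (cr F θ hP g₀ os).Bad
            (fun K t τ => (cr F θ hP g₀ os).A K t τ - (cr F θ hP g₀ os).shA K t τ) (fun K t τ => (cr F θ hP g₀ os).B K t τ - (cr F θ hP g₀ os).shB K t τ) δ ∧
            Summable δ) :
    SpineGivenEndpointR13 :=
  spineGivenEndpointR13_of_spine_rec13C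
    (spine_rec13C_of_rateStubs_twoKeys₁₃ cr rr SRec RRec hkeyS hkeyR hx h14 h15 h16 h17 h18 h22 hx' h20 h21 h19₂)

end Knits

/-! ## §3 The cluster-level keyed faces: K3‴ from K5 «SpineDatum» (and K4's hook) READ AT THE GUARDED STAGE-13 TUPLES — the shape `closes` consumes -/

section KeyedClusters

variable (Inputs : InputsPred 2)

/-- **THE ITEM FROM THE K5 CLUSTER STATEMENT KEYED AT THE GUARDED STAGE-13 TUPLES** (`N = 2`): if at every Stage-13 θ with provisos, `θ.ZtUnity F 2`, `θ.SlotsNondegenerate₁₃ F 2`,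
`θ.Admissible F 2`, under (B) and END at the datum of record, for all small tuned `g₀` and EVERY loop string the per-string SPINE DATUM `YMDAG.UVSplit.SpineDatum` holds (N20 ∧ N21 ∧ N19-on-cores
∧ budget ∧ `Summable δ` ∧ E1∕E2 at explicit carriers — R420's unguarded K5), then `SpineGivenEndpointR13` — per string by the route module's `stringHybridNE7_of_spineDatum`.  No record
predicate, no world. [bookkeeping] -/
theorem spineGivenEndpointR13_of_keyedSpineDatum
    (h5 : ∀ (F : T4Family) (θ : Stage13Params F 2) (hP : θ.Provisos₁₃ F 2), (θ.ZtUnity F 2 ∧ θ.SlotsNondegenerate₁₃ F 2) → θ.Admissible F 2 →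
      B16.EndStatementBPrinted (datumOfRecord₁₃ F 2 θ hP).C → DagBinding.EndpointExistence (datumOfRecord₁₃ F 2 θ hP).C.toB12 →
        ForSmallCouplings (datumOfRecord₁₃ F 2 θ hP) fun g₀ => ∀ os : List (ULoop F), SpineDatum (datumOfRecord₁₃ F 2 θ hP) g₀ os) :
    SpineGivenEndpointR13 := by
  intro F θ hP hG hθ _ _
  show (datumOfRecord₁₃ F 2 θ hP).UnderHypotheses _ fun g₀ => T4ApexHybrid.StringwiseHybridNE7 ((datumOfRecord₁₃ F 2 θ hP).scheme g₀)
  intro hB hEnd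
  exact (h5 F θ hP hG hθ hB hEnd).mono fun g₀ hg => stringHybridNE7_of_spineDatum _ g₀ hg

/-- **THE ITEM FROM K4's HOOK AND K5 BOTH KEYED AT THE GUARDED STAGE-13 TUPLES** (`N = 2`; the route glue `B5_at_record`'s mechanism, θ-keyed): K4 «for all small tuned `g₀`, every `os`:
`Inputs`» and K5 «… `Inputs → SpineDatum`» at every guarded θ ⇒ `SpineGivenEndpointR13` (`ForSmallCouplings.and`, modus ponens per string). [bookkeeping] -/
theorem spineGivenEndpointR13_of_keyedSpineRates_spineMatching
    (h4 : ∀ (F : T4Family) (θ : Stage13Params F 2) (hP : θ.Provisos₁₃ F 2), (θ.ZtUnity F 2 ∧ θ.SlotsNondegenerate₁₃ F 2) → θ.Admissible F 2 →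
      B16.EndStatementBPrinted (datumOfRecord₁₃ F 2 θ hP).C → DagBinding.EndpointExistence (datumOfRecord₁₃ F 2 θ hP).C.toB12 →
        ForSmallCouplings (datumOfRecord₁₃ F 2 θ hP) fun g₀ => ∀ os : List (ULoop F), Inputs F (datumOfRecord₁₃ F 2 θ hP) g₀ os)
    (h5 : ∀ (F : T4Family) (θ : Stage13Params F 2) (hP : θ.Provisos₁₃ F 2), (θ.ZtUnity F 2 ∧ θ.SlotsNondegenerate₁₃ F 2) → θ.Admissible F 2 →
      B16.EndStatementBPrinted (datumOfRecord₁₃ F 2 θ hP).C → DagBinding.EndpointExistence (datumOfRecord₁₃ F 2 θ hP).C.toB12 →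
        ForSmallCouplings (datumOfRecord₁₃ F 2 θ hP) fun g₀ => ∀ os : List (ULoop F),
          Inputs F (datumOfRecord₁₃ F 2 θ hP) g₀ os → SpineDatum (datumOfRecord₁₃ F 2 θ hP) g₀ os) :
    SpineGivenEndpointR13 := by
  intro F θ hP hG hθ _ _
  show (datumOfRecord₁₃ F 2 θ hP).UnderHypotheses _ fun g₀ => T4ApexHybrid.StringwiseHybridNE7 ((datumOfRecord₁₃ F 2 θ hP).scheme g₀)
  intro hB hEnd
  exact ((h4 F θ hP hG hθ hB hEnd).and (h5 F θ hP hG hθ hB hEnd)).mono fun g₀ hg =>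
    stringHybridNE7_of_spineDatum _ g₀ fun os => hg.2 os (hg.1 os)

end KeyedClusters

/-! ## §4 THE ITEM IS «B5 AT node00-def-RR-2's CN RECORD CLASS» (`Node00.IsRecordOfRecord₁₃CN F 2` = the Stage-13 records whose parameter carries print's partition of unity AND
non-degenerate present slots, `Node00/Record13DatumKey` §7; module XXXVI §7) -/

section RegimeRecord

/-- **THE ITEM ⟺ B5 `Spine` AT THE CN RECORD CLASS OF RECORD** (`N = 2`): `SpineGivenEndpointR13` holds iff `T4ApexHybrid.HybridNE7Under D END` at EVERY Stage-13 record `(D, w)`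
realised by an admissible tuple with provisos satisfying `θ.ZtUnity F 2 ∧ θ.SlotsNondegenerate₁₃ F 2` (§1 `spineGivenEndpointR13_iff_keyedGuarded` ∘ XXXVI `spine_rec13CN_iff_forall_guarded`,
i.e. RR-2's junction `forall_isRecordOfRecord₁₃CN_iff`).  So every record-level road of this package (XII∕XIV∕XXIV∕XXXVI∕XXXVIII∕XXXIX) run at `Rec := IsRecordOfRecord₁₃CN F 2` concludes the
item EXACTLY — neither the stronger `Spine ₁₃C` nor a weakening; e.g. XXXVI `spine_rec13COn_of_keyedFaces` at `Rg := Node00.unityNondeg₁₃ 2`. [bookkeeping] -/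
theorem spineGivenEndpointR13_iff_spine_rec13CN :
    SpineGivenEndpointR13 ↔ Spine (N := 2) fun F D w => Node00.IsRecordOfRecord₁₃CN F 2 D w :=
  spineGivenEndpointR13_iff_keyedGuarded.trans (spine_rec13CN_iff_forall_guarded (N := 2)).symm

/-- **THE ITEM FROM B5 AT THE RECORD CLASS OF ANY REGIME CONTAINING THE GUARD** (`N = 2`; XXXVI `spine_rec13COn_anti`): e.g. the trivial regime (`Spine ₁₃C`, §1), the unity
regime `θ.ZtUnity F 2` alone, or the guard itself. [bookkeeping] -/
theorem spineGivenEndpointR13_of_spine_rec13COn {Rg : (F : T4Family) → Stage13Params F 2 → Prop}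
    (hle : ∀ (F : T4Family) (θ : Stage13Params F 2), (θ.ZtUnity F 2 ∧ θ.SlotsNondegenerate₁₃ F 2) → Rg F θ)
    (h : Spine (N := 2) fun F D w => Node00.IsRecordOfRecord₁₃COn F 2 Rg D w) : SpineGivenEndpointR13 :=
  spineGivenEndpointR13_iff_spine_rec13CN.mpr (spine_rec13COn_anti (Rg := Node00.unityNondeg₁₃ 2) hle h)

end RegimeRecord

/-! ## §5 The item from the Stage-13 CARRIER HOMES OF RECORD (module XXXVIII by name) — `S_R00x` discharged at the home -/

section Homes

variable (cr₁₃ : SpineReading₁₃ 2) (𝔯 : RateReading₁₃ 2)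

/-- **THE ITEM FROM THE STUB INSTANCES OF THE TWO STAGE-13 CARRIER HOMES OF RECORD AND THE HOME-KEYED N19′ EDGE** (`N = 2`; XXXVIII `spine_rec13C_of_homes₁₃` ∘ §1): the six K4 stubs at
(T-RATE)₁₃ `RRec₁₃ 𝔯`, the three K5 stubs at (T-SPINE)₁₃ `SRec₁₃ cr₁₃`, and `h19` (for every admissible θ, every datum key `h` of θ's datum, every run length `k`: the rates at the canonical
bundle `rateCarriersOfRecord₁₃ 𝔯 F h.params h.provisos g₀ os k` give a summable `δ` carrying `Spine.NE7.Core` on the cores of `cr₁₃ F θ hP g₀ os`) ⇒ `SpineGivenEndpointR13` — `S_R00x`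
is NOT asked (proved at the home, `s_R00x_rRec₁₃`).  Every remaining stub 0∕1 today; `cr₁₃`, `𝔯` the homes' PARAMETERS. [bookkeeping] -/
theorem spineGivenEndpointR13_of_homes₁₃ (h14 : S_N14 (RRec₁₃ 𝔯)) (h15 : S_N15 (RRec₁₃ 𝔯)) (h16 : S_N16 (RRec₁₃ 𝔯)) (h17 : S_N17 (RRec₁₃ 𝔯))
    (h18 : S_N18 (RRec₁₃ 𝔯)) (h22 : S_N22 (RRec₁₃ 𝔯)) (hx' : S_N27x (fun F D w => IsRecordOfRecord₁₃C F 2 D w) (SRec₁₃ cr₁₃)) (h20 : S_N20 (SRec₁₃ cr₁₃))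
    (h21 : S_N21 (SRec₁₃ cr₁₃))
    (h19 : ∀ (F : T4Family) (θ : Stage13Params F 2) (hP : θ.Provisos₁₃ F 2), θ.Admissible F 2 → ∀ (g₀ : ℕ → ℝ) (os : List (ULoop F))
      (h : Node00.IsDatumOfRecord₁₃C F 2 (datumOfRecord₁₃ F 2 θ hP)) (k : ℕ),
      RatesAt (datumOfRecord₁₃ F 2 θ hP) (rateCarriersOfRecord₁₃ 𝔯 F h.params h.provisos g₀ os k) → letI := (cr₁₃ F θ hP g₀ os).dec
        ∃ δ : ℕ → ℝ, NE7.Core (cr₁₃ F θ hP g₀ os).l₀ (cr₁₃ F θ hP g₀ os).vol (cr₁₃ F θ hP g₀ os).T (cr₁₃ F θ hP g₀ os).Bad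
          (fun K t τ => (cr₁₃ F θ hP g₀ os).A K t τ - (cr₁₃ F θ hP g₀ os).shA K t τ)
          (fun K t τ => (cr₁₃ F θ hP g₀ os).B K t τ - (cr₁₃ F θ hP g₀ os).shB K t τ) δ ∧ Summable δ) :
    SpineGivenEndpointR13 :=
  spineGivenEndpointR13_of_spine_rec13C (spine_rec13C_of_homes₁₃ cr₁₃ 𝔯 h14 h15 h16 h17 h18 h22 hx' h20 h21 h19)

end Homes

/-! ## §6 The item from the REGIME-RESTRICTED Stage-13 carrier homes at the rev-16 guard (module XXXIX by name) — the guard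
`θ.ZtUnity F 2 ∧ θ.SlotsNondegenerate₁₃ F 2` REACHES BOTH HOMES AND THE EDGE (dag-ref-H XXVII-PRE-READ-NOTE shape (b)); no canonical parameter, `S_R00x` not asked -/

section HomesOn

variable (cr₁₃ : SpineReading₁₃ 2) (𝔯 : RateReading₁₃ 2)

/-- **THE ITEM FROM THE STUB INSTANCES OF THE TWO REGIME-RESTRICTED STAGE-13 CARRIER HOMES AT THE ITEM'S OWN GUARD** (`N = 2`; XXXIX `forall_guarded₁₃_of_homes₁₃On` at
`Rg F θ := θ.ZtUnity F 2 ∧ θ.SlotsNondegenerate₁₃ F 2` ∘ §1 `spineGivenEndpointR13_iff_keyedGuarded`): the six K4 stubs at (T-RATE)₁₃ `RRec₁₃On 𝔯 Rg` and the K5 stubs `S_N20`, `S_N21` at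
(T-SPINE)₁₃ `SRec₁₃On cr₁₃ Rg` — each IS its node's estimate asked ONLY of the admissible Stage-13 tuples with provisos satisfying the guard, read AT the tuple (n22-e `s_N1x_rRec₁₃On_iff`,
n20-d `s_N20_sRec₁₃On_iff`) — the keyed extraction clause `hx` (positivity + E1∕E2 under (B), END, small tuned couplings) and the SAME-TUPLE, ALL-RUN-LENGTHS N19′ edge `h19`, both asked
only under the guard ⇒ `SpineGivenEndpointR13`.  Unlike §5's `_of_homes₁₃` (canonical homes, edge read at `h.params`, stubs at EVERY admissible tuple), here the item's guard is
supplied to EVERY hypothesis and nothing is read at a canonical parameter.  Every hypothesis 0∕1 today; `cr₁₃`, `𝔯` the homes' PARAMETERS. [bookkeeping] -/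
theorem spineGivenEndpointR13_of_homes₁₃On
    (h14 : S_N14 (RRec₁₃On 𝔯 fun F θ => θ.ZtUnity F 2 ∧ θ.SlotsNondegenerate₁₃ F 2)) (h15 : S_N15 (RRec₁₃On 𝔯 fun F θ => θ.ZtUnity F 2 ∧ θ.SlotsNondegenerate₁₃ F 2))
    (h16 : S_N16 (RRec₁₃On 𝔯 fun F θ => θ.ZtUnity F 2 ∧ θ.SlotsNondegenerate₁₃ F 2)) (h17 : S_N17 (RRec₁₃On 𝔯 fun F θ => θ.ZtUnity F 2 ∧ θ.SlotsNondegenerate₁₃ F 2))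
    (h18 : S_N18 (RRec₁₃On 𝔯 fun F θ => θ.ZtUnity F 2 ∧ θ.SlotsNondegenerate₁₃ F 2)) (h22 : S_N22 (RRec₁₃On 𝔯 fun F θ => θ.ZtUnity F 2 ∧ θ.SlotsNondegenerate₁₃ F 2))
    (h20 : S_N20 (SRec₁₃On cr₁₃ fun F θ => θ.ZtUnity F 2 ∧ θ.SlotsNondegenerate₁₃ F 2)) (h21 : S_N21 (SRec₁₃On cr₁₃ fun F θ => θ.ZtUnity F 2 ∧ θ.SlotsNondegenerate₁₃ F 2))
    (hx : ∀ (F : T4Family) (θ : Stage13Params F 2) (hP : θ.Provisos₁₃ F 2), (θ.ZtUnity F 2 ∧ θ.SlotsNondegenerate₁₃ F 2) → θ.Admissible F 2 →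
      B16.EndStatementBPrinted (datumOfRecord₁₃ F 2 θ hP).C → DagBinding.EndpointExistence (datumOfRecord₁₃ F 2 θ hP).C.toB12 →
        ForSmallCouplings (datumOfRecord₁₃ F 2 θ hP) fun g₀ => ∀ os : List (ULoop F),
          0 < (cr₁₃ F θ hP g₀ os).l₀ ∧ 0 < (cr₁₃ F θ hP g₀ os).vol ∧
          (∀ (K : ℕ) (t : ℝ), |t| ≤ (cr₁₃ F θ hP g₀ os).l₀ →
            T4GenFunBounds.schemeZ ((datumOfRecord₁₃ F 2 θ hP).scheme g₀) os ((cr₁₃ F θ hP g₀ os).K₀ + K) t =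
              ∑ τ ∈ (cr₁₃ F θ hP g₀ os).T K, (cr₁₃ F θ hP g₀ os).A K t τ) ∧
          (∀ (K : ℕ) (t : ℝ), |t| ≤ (cr₁₃ F θ hP g₀ os).l₀ →
            T4GenFunBounds.schemeZ ((datumOfRecord₁₃ F 2 θ hP).scheme g₀) os ((cr₁₃ F θ hP g₀ os).K₀ + K + 1) t =
              ∑ τ ∈ (cr₁₃ F θ hP g₀ os).T K, (cr₁₃ F θ hP g₀ os).B K t τ))
    (h19 : ∀ (F : T4Family) (θ : Stage13Params F 2) (hP : θ.Provisos₁₃ F 2), (θ.ZtUnity F 2 ∧ θ.SlotsNondegenerate₁₃ F 2) → θ.Admissible F 2 →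
      ∀ (g₀ : ℕ → ℝ) (os : List (ULoop F)), (∀ k : ℕ, RatesAt (datumOfRecord₁₃ F 2 θ hP) (rateCarriersOfRecord₁₃ 𝔯 F θ hP g₀ os k)) → letI := (cr₁₃ F θ hP g₀ os).dec
        ∃ δ : ℕ → ℝ, NE7.Core (cr₁₃ F θ hP g₀ os).l₀ (cr₁₃ F θ hP g₀ os).vol (cr₁₃ F θ hP g₀ os).T (cr₁₃ F θ hP g₀ os).Bad
          (fun K t τ => (cr₁₃ F θ hP g₀ os).A K t τ - (cr₁₃ F θ hP g₀ os).shA K t τ)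
          (fun K t τ => (cr₁₃ F θ hP g₀ os).B K t τ - (cr₁₃ F θ hP g₀ os).shB K t τ) δ ∧ Summable δ) :
    SpineGivenEndpointR13 :=
  spineGivenEndpointR13_iff_keyedGuarded.mpr
    (forall_guarded₁₃_of_homes₁₃On cr₁₃ 𝔯 (fun F θ => θ.ZtUnity F 2 ∧ θ.SlotsNondegenerate₁₃ F 2) h14 h15 h16 h17 h18 h22 h20 h21 hx h19)

/-- **THE SAME WITH EVERY HYPOTHESIS IN ITS GUARDED θ-FORM** (`N = 2`; XXXIX `forall_guarded₁₃_of_homes₁₃On_faces`): at every Stage-13 θ with provisos satisfying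
`θ.ZtUnity F 2 ∧ θ.SlotsNondegenerate₁₃ F 2` and `θ.Admissible F 2`, every `g₀`, `os` — K4's six rates at EVERY run length `k` of the rate reading `rateCarriersOfRecord₁₃ 𝔯 F θ hP g₀ os k` on
the datum of record · N20 `RelWeightBound` and N21 `ShellWeightBound` at the spine reading `cr₁₃ F θ hP g₀ os` · the keyed extraction clause · the same-tuple all-run-lengths N19′ edge ⇒
`SpineGivenEndpointR13`.  The BC3-composer shape of §2's `spineGivenEndpointR13_of_keyedFaces` with the rate reading THE HOME's (run-length-indexed) and the edge fed the rates at all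
run lengths. [bookkeeping] -/
theorem spineGivenEndpointR13_of_homes₁₃On_faces
    (hrates : ∀ (F : T4Family) (θ : Stage13Params F 2) (hP : θ.Provisos₁₃ F 2), (θ.ZtUnity F 2 ∧ θ.SlotsNondegenerate₁₃ F 2) → θ.Admissible F 2 →
      ∀ (g₀ : ℕ → ℝ) (os : List (ULoop F)) (k : ℕ), RatesAt (datumOfRecord₁₃ F 2 θ hP) (rateCarriersOfRecord₁₃ 𝔯 F θ hP g₀ os k))
    (h20 : ∀ (F : T4Family) (θ : Stage13Params F 2) (hP : θ.Provisos₁₃ F 2), (θ.ZtUnity F 2 ∧ θ.SlotsNondegenerate₁₃ F 2) → θ.Admissible F 2 →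
      ∀ (g₀ : ℕ → ℝ) (os : List (ULoop F)),
      RelWeightBound (cr₁₃ F θ hP g₀ os).l₀ (cr₁₃ F θ hP g₀ os).T (cr₁₃ F θ hP g₀ os).A (cr₁₃ F θ hP g₀ os).B (cr₁₃ F θ hP g₀ os).Bad (cr₁₃ F θ hP g₀ os).W)
    (h21 : ∀ (F : T4Family) (θ : Stage13Params F 2) (hP : θ.Provisos₁₃ F 2), (θ.ZtUnity F 2 ∧ θ.SlotsNondegenerate₁₃ F 2) → θ.Admissible F 2 →
      ∀ (g₀ : ℕ → ℝ) (os : List (ULoop F)),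
      ShellWeightBound (cr₁₃ F θ hP g₀ os).l₀ (cr₁₃ F θ hP g₀ os).T (cr₁₃ F θ hP g₀ os).A (cr₁₃ F θ hP g₀ os).B (cr₁₃ F θ hP g₀ os).shA (cr₁₃ F θ hP g₀ os).shB
        (cr₁₃ F θ hP g₀ os).Wsh)
    (hx : ∀ (F : T4Family) (θ : Stage13Params F 2) (hP : θ.Provisos₁₃ F 2), (θ.ZtUnity F 2 ∧ θ.SlotsNondegenerate₁₃ F 2) → θ.Admissible F 2 →
      B16.EndStatementBPrinted (datumOfRecord₁₃ F 2 θ hP).C → DagBinding.EndpointExistence (datumOfRecord₁₃ F 2 θ hP).C.toB12 →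
        ForSmallCouplings (datumOfRecord₁₃ F 2 θ hP) fun g₀ => ∀ os : List (ULoop F),
          0 < (cr₁₃ F θ hP g₀ os).l₀ ∧ 0 < (cr₁₃ F θ hP g₀ os).vol ∧
          (∀ (K : ℕ) (t : ℝ), |t| ≤ (cr₁₃ F θ hP g₀ os).l₀ →
            T4GenFunBounds.schemeZ ((datumOfRecord₁₃ F 2 θ hP).scheme g₀) os ((cr₁₃ F θ hP g₀ os).K₀ + K) t =
              ∑ τ ∈ (cr₁₃ F θ hP g₀ os).T K, (cr₁₃ F θ hP g₀ os).A K t τ) ∧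
          (∀ (K : ℕ) (t : ℝ), |t| ≤ (cr₁₃ F θ hP g₀ os).l₀ →
            T4GenFunBounds.schemeZ ((datumOfRecord₁₃ F 2 θ hP).scheme g₀) os ((cr₁₃ F θ hP g₀ os).K₀ + K + 1) t =
              ∑ τ ∈ (cr₁₃ F θ hP g₀ os).T K, (cr₁₃ F θ hP g₀ os).B K t τ))
    (h19 : ∀ (F : T4Family) (θ : Stage13Params F 2) (hP : θ.Provisos₁₃ F 2), (θ.ZtUnity F 2 ∧ θ.SlotsNondegenerate₁₃ F 2) → θ.Admissible F 2 →
      ∀ (g₀ : ℕ → ℝ) (os : List (ULoop F)), (∀ k : ℕ, RatesAt (datumOfRecord₁₃ F 2 θ hP) (rateCarriersOfRecord₁₃ 𝔯 F θ hP g₀ os k)) → letI := (cr₁₃ F θ hP g₀ os).dec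
        ∃ δ : ℕ → ℝ, NE7.Core (cr₁₃ F θ hP g₀ os).l₀ (cr₁₃ F θ hP g₀ os).vol (cr₁₃ F θ hP g₀ os).T (cr₁₃ F θ hP g₀ os).Bad
          (fun K t τ => (cr₁₃ F θ hP g₀ os).A K t τ - (cr₁₃ F θ hP g₀ os).shA K t τ)
          (fun K t τ => (cr₁₃ F θ hP g₀ os).B K t τ - (cr₁₃ F θ hP g₀ os).shB K t τ) δ ∧ Summable δ) :
    SpineGivenEndpointR13 :=
  spineGivenEndpointR13_iff_keyedGuarded.mpr
    (forall_guarded₁₃_of_homes₁₃On_faces cr₁₃ 𝔯 (fun F θ => θ.ZtUnity F 2 ∧ θ.SlotsNondegenerate₁₃ F 2) hrates h20 h21 hx h19)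

end HomesOn

/-! ## §7 The item from the stubs at the guard-restricted homes THROUGH RR-2's CN record class (module XXXIX `spine_rec13CN_of_homes₁₃On`) -/

section HomesCN

/-- **THE ITEM FROM THE STUBS AT THE GUARD-RESTRICTED HOMES, THROUGH THE CN RECORD CLASS** (`N = 2`; XXXIX `spine_rec13CN_of_homes₁₃On` ∘ `spineGivenEndpointR13_iff_spine_rec13CN`):
§6's `spineGivenEndpointR13_of_homes₁₃On` with the regime spelled `Node00.unityNondeg₁₃ 2` (RR-2's name for the guard of record) — the same term up to the abbreviation.
[bookkeeping] -/
theorem spineGivenEndpointR13_of_homes₁₃CN (cr₁₃ : SpineReading₁₃ 2) (𝔯 : RateReading₁₃ 2)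
    (h14 : S_N14 (RRec₁₃On 𝔯 (Node00.unityNondeg₁₃ 2))) (h15 : S_N15 (RRec₁₃On 𝔯 (Node00.unityNondeg₁₃ 2))) (h16 : S_N16 (RRec₁₃On 𝔯 (Node00.unityNondeg₁₃ 2)))
    (h17 : S_N17 (RRec₁₃On 𝔯 (Node00.unityNondeg₁₃ 2))) (h18 : S_N18 (RRec₁₃On 𝔯 (Node00.unityNondeg₁₃ 2))) (h22 : S_N22 (RRec₁₃On 𝔯 (Node00.unityNondeg₁₃ 2)))
    (h20 : S_N20 (SRec₁₃On cr₁₃ (Node00.unityNondeg₁₃ 2))) (h21 : S_N21 (SRec₁₃On cr₁₃ (Node00.unityNondeg₁₃ 2)))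
    (hx : ∀ (F : T4Family) (θ : Stage13Params F 2) (hP : θ.Provisos₁₃ F 2), (θ.ZtUnity F 2 ∧ θ.SlotsNondegenerate₁₃ F 2) → θ.Admissible F 2 →
      B16.EndStatementBPrinted (datumOfRecord₁₃ F 2 θ hP).C → DagBinding.EndpointExistence (datumOfRecord₁₃ F 2 θ hP).C.toB12 →
        ForSmallCouplings (datumOfRecord₁₃ F 2 θ hP) fun g₀ => ∀ os : List (ULoop F),
          0 < (cr₁₃ F θ hP g₀ os).l₀ ∧ 0 < (cr₁₃ F θ hP g₀ os).vol ∧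
          (∀ (K : ℕ) (t : ℝ), |t| ≤ (cr₁₃ F θ hP g₀ os).l₀ →
            T4GenFunBounds.schemeZ ((datumOfRecord₁₃ F 2 θ hP).scheme g₀) os ((cr₁₃ F θ hP g₀ os).K₀ + K) t =
              ∑ τ ∈ (cr₁₃ F θ hP g₀ os).T K, (cr₁₃ F θ hP g₀ os).A K t τ) ∧
          (∀ (K : ℕ) (t : ℝ), |t| ≤ (cr₁₃ F θ hP g₀ os).l₀ →
            T4GenFunBounds.schemeZ ((datumOfRecord₁₃ F 2 θ hP).scheme g₀) os ((cr₁₃ F θ hP g₀ os).K₀ + K + 1) t =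
              ∑ τ ∈ (cr₁₃ F θ hP g₀ os).T K, (cr₁₃ F θ hP g₀ os).B K t τ))
    (h19 : ∀ (F : T4Family) (θ : Stage13Params F 2) (hP : θ.Provisos₁₃ F 2), (θ.ZtUnity F 2 ∧ θ.SlotsNondegenerate₁₃ F 2) → θ.Admissible F 2 →
      ∀ (g₀ : ℕ → ℝ) (os : List (ULoop F)), (∀ k : ℕ, RatesAt (datumOfRecord₁₃ F 2 θ hP) (rateCarriersOfRecord₁₃ 𝔯 F θ hP g₀ os k)) → letI := (cr₁₃ F θ hP g₀ os).dec
        ∃ δ : ℕ → ℝ, NE7.Core (cr₁₃ F θ hP g₀ os).l₀ (cr₁₃ F θ hP g₀ os).vol (cr₁₃ F θ hP g₀ os).T (cr₁₃ F θ hP g₀ os).Bad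
          (fun K t τ => (cr₁₃ F θ hP g₀ os).A K t τ - (cr₁₃ F θ hP g₀ os).shA K t τ)
          (fun K t τ => (cr₁₃ F θ hP g₀ os).B K t τ - (cr₁₃ F θ hP g₀ os).shB K t τ) δ ∧ Summable δ) :
    SpineGivenEndpointR13 :=
  spineGivenEndpointR13_iff_spine_rec13CN.mpr (spine_rec13CN_of_homes₁₃On cr₁₃ 𝔯 h14 h15 h16 h17 h18 h22 h20 h21 hx h19)

end HomesCN

/-! ## §8 (v1.1, append-only) THE ITEM AT dag-n22-e's STAGE-13 RATE READING OF RECORD `readingOfRecord₁₃ w1 ℓ₃ ne2 ne1` (module XL by name) -/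

section ReadingOfRecord

open Node00 (IsDatumOfRecord₁₃C NE3Letters₁₁ NE2Objects₁₁ ne3ConstLayerOfRecord₁₁)
open Summit.QuantumFields.YangMills.BalabanUVNodes.N16Regime (InEndRegime)
open Summit.QuantumFields.YangMills.BalabanUVNodes.N16LeafSlot (LeafSlot)

variable (cr₁₃ : SpineReading₁₃ 2)
  (w1 : (F : T4Family) → (θ : Stage13Params F 2) → Node00.W1.ReadingData F (Node00.MatA 2) θ.τ9.M) (ℓ₃ : T4Family → NE3Letters₁₁)
  (ne2 : (F : T4Family) → Stage13Params F 2 → (ℕ → ℝ) → List (ULoop F) → ℕ → NE2Objects₁₁)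
  (ne1 : (F : T4Family) → Stage13Params F 2 → (ℕ → ℝ) → List (ULoop F) → NE1pCarriers)

/-- **K3‴ FROM THE RATE SENTENCES AT THE GUARD-RESTRICTED HOME OF THE ₁₃ READING OF RECORD** (`N = 2`; §4 `spineGivenEndpointR13_of_spine_rec13COn` at the guard ∘ XL
`spine_rec13COn_at_readingOfRecord₁₃_of_leafSlot`): NE1′ on `ne1`, NE2 on `ne2`, NE5 ∕ NE9 ∕ (D4) on `(w1 F θ).u3Objects θ.γ` per run length, `InEndRegime ∧ LeafSlot` once per guarded
family, N17 ELIMINATED, N20 ∕ N21 at `SRec₁₃On cr₁₃ (guard)`, the guarded extraction clause and the same-tuple N19′ edge — the guard reaching EVERY hypothesis ⇒ `SpineGivenEndpointR13`.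
Every hypothesis 0∕1 today. [bookkeeping] -/
theorem spineGivenEndpointR13_at_readingOfRecord₁₃On
    (h14 : ∀ (F : T4Family) (θ : Stage13Params F 2), θ.Provisos₁₃ F 2 → (θ.ZtUnity F 2 ∧ θ.SlotsNondegenerate₁₃ F 2) → θ.Admissible F 2 →
      ∀ (g₀ : ℕ → ℝ) (os : List (ULoop F)), N14At (ne1 F θ g₀ os))
    (h15 : ∀ (F : T4Family) (θ : Stage13Params F 2), θ.Provisos₁₃ F 2 → (θ.ZtUnity F 2 ∧ θ.SlotsNondegenerate₁₃ F 2) → θ.Admissible F 2 →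
      ∀ (g₀ : ℕ → ℝ) (os : List (ULoop F)) (k : ℕ), N15At (ne2OfRecord₁₁ (ne2 F θ g₀ os k)))
    (h16 : ∀ (F : T4Family), (∃ θ : Stage13Params F 2, θ.Provisos₁₃ F 2 ∧ (θ.ZtUnity F 2 ∧ θ.SlotsNondegenerate₁₃ F 2) ∧ θ.Admissible F 2) →
      InEndRegime (ne3OfRecord₁₁ F (ne3ConstLayerOfRecord₁₁ F 2 (ℓ₃ F))) ∧ LeafSlot (ne3OfRecord₁₁ F (ne3ConstLayerOfRecord₁₁ F 2 (ℓ₃ F))))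
    (h18 : ∀ (F : T4Family) (θ : Stage13Params F 2), θ.Provisos₁₃ F 2 → (θ.ZtUnity F 2 ∧ θ.SlotsNondegenerate₁₃ F 2) → θ.Admissible F 2 → ∀ k : ℕ,
      N18At (u3OfRecord₁₃ θ ((w1 F θ).u3Objects θ.γ) k))
    (h22 : ∀ (F : T4Family) (θ : Stage13Params F 2), θ.Provisos₁₃ F 2 → (θ.ZtUnity F 2 ∧ θ.SlotsNondegenerate₁₃ F 2) → θ.Admissible F 2 → ∀ k : ℕ,
      N22At (u3OfRecord₁₃ θ ((w1 F θ).u3Objects θ.γ) k))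
    (hD4 : ∀ (F : T4Family) (θ : Stage13Params F 2) (hP : θ.Provisos₁₃ F 2), (θ.ZtUnity F 2 ∧ θ.SlotsNondegenerate₁₃ F 2) → θ.Admissible F 2 → ∀ k : ℕ,
      ReadOutAt (datumOfRecord₁₃ F 2 θ hP) (u3OfRecord₁₃ θ ((w1 F θ).u3Objects θ.γ) k))
    (h20 : S_N20 (SRec₁₃On cr₁₃ fun F θ => θ.ZtUnity F 2 ∧ θ.SlotsNondegenerate₁₃ F 2))
    (h21 : S_N21 (SRec₁₃On cr₁₃ fun F θ => θ.ZtUnity F 2 ∧ θ.SlotsNondegenerate₁₃ F 2))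
    (hx : ∀ (F : T4Family) (θ : Stage13Params F 2) (hP : θ.Provisos₁₃ F 2), (θ.ZtUnity F 2 ∧ θ.SlotsNondegenerate₁₃ F 2) → θ.Admissible F 2 →
      B16.EndStatementBPrinted (datumOfRecord₁₃ F 2 θ hP).C → DagBinding.EndpointExistence (datumOfRecord₁₃ F 2 θ hP).C.toB12 →
        ForSmallCouplings (datumOfRecord₁₃ F 2 θ hP) fun g₀ => ∀ os : List (ULoop F),
          0 < (cr₁₃ F θ hP g₀ os).l₀ ∧ 0 < (cr₁₃ F θ hP g₀ os).vol ∧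
          (∀ (K : ℕ) (t : ℝ), |t| ≤ (cr₁₃ F θ hP g₀ os).l₀ →
            T4GenFunBounds.schemeZ ((datumOfRecord₁₃ F 2 θ hP).scheme g₀) os ((cr₁₃ F θ hP g₀ os).K₀ + K) t =
              ∑ τ ∈ (cr₁₃ F θ hP g₀ os).T K, (cr₁₃ F θ hP g₀ os).A K t τ) ∧
          (∀ (K : ℕ) (t : ℝ), |t| ≤ (cr₁₃ F θ hP g₀ os).l₀ →
            T4GenFunBounds.schemeZ ((datumOfRecord₁₃ F 2 θ hP).scheme g₀) os ((cr₁₃ F θ hP g₀ os).K₀ + K + 1) t =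
              ∑ τ ∈ (cr₁₃ F θ hP g₀ os).T K, (cr₁₃ F θ hP g₀ os).B K t τ))
    (h19 : ∀ (F : T4Family) (θ : Stage13Params F 2) (hP : θ.Provisos₁₃ F 2), (θ.ZtUnity F 2 ∧ θ.SlotsNondegenerate₁₃ F 2) → θ.Admissible F 2 →
      ∀ (g₀ : ℕ → ℝ) (os : List (ULoop F)),
      (∀ k : ℕ, RatesAt (datumOfRecord₁₃ F 2 θ hP) (rateCarriersOfRecord₁₃ (readingOfRecord₁₃ w1 ℓ₃ ne2 ne1) F θ hP g₀ os k)) → letI := (cr₁₃ F θ hP g₀ os).dec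
        ∃ δ : ℕ → ℝ, NE7.Core (cr₁₃ F θ hP g₀ os).l₀ (cr₁₃ F θ hP g₀ os).vol (cr₁₃ F θ hP g₀ os).T (cr₁₃ F θ hP g₀ os).Bad
          (fun K t τ => (cr₁₃ F θ hP g₀ os).A K t τ - (cr₁₃ F θ hP g₀ os).shA K t τ)
          (fun K t τ => (cr₁₃ F θ hP g₀ os).B K t τ - (cr₁₃ F θ hP g₀ os).shB K t τ) δ ∧ Summable δ) :
    SpineGivenEndpointR13 :=
  spineGivenEndpointR13_of_spine_rec13COn (Rg := fun F θ => θ.ZtUnity F 2 ∧ θ.SlotsNondegenerate₁₃ F 2) (fun _ _ h => h)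
    (spine_rec13COn_at_readingOfRecord₁₃_of_leafSlot cr₁₃ w1 ℓ₃ ne2 ne1 (fun F θ => θ.ZtUnity F 2 ∧ θ.SlotsNondegenerate₁₃ F 2)
      h14 h15 h16 h18 h22 hD4 h20 h21 hx h19)

end ReadingOfRecord

end Summit.QuantumFields.YangMills.Theorems.BalabanUVNodesN27SpineRecord
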